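import Literature.AnabelianGeometry.SemiGraphs.Arithmetic
import Literature.AnabelianGeometry.AbsoluteAnabelian.NFGaloisNotTFGProofs
import Literature.AnabelianGeometry.AbsoluteAnabelian.FundamentalExtension
import Mathlib.Algebra.Group.PUnit
import HarnessLib

/-!
# [SemiAnbd] Def. 5.1 (i)(a) `Def51CondA` ("`π̂₁(A)` is topologically finitely generated") as a FACT-LIST
# row (F-0263): kernel closure census

Mochizuki, *Semi-graphs of anabelioids*, Publ. RIMS **42** (2006), §5, Def. 5.1 (i)(a) p. 62
[cite: MochizukiSemiAnbd2006, Def 5.1 (i)(a), p. 62].  abc-iut cell, D-0078 fact-proving wave, row F-0263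
of tranche 157 (`plan/F-TRANCHES.tsv`; seat abc-iut-w5-d095, gen 4); PROOF-ONLY companion of
`Arithmetic.lean` (abc-iut-L3-t3), where `Def51CondA (PA : ProfiniteGrp) : Prop :=
IsTopologicallyFinitelyGenerated PA` is condition (a) of the DEFINITION of an arithmetic semi-graph of
anabelioids — a HYPOTHESIS on the datum `π̂₁(A)`, not a theorem.  No definition is introduced or restated.

WHAT IS RECORDED.

* `not_def51CondA_absoluteGaloisGrp` — the condition FAILS at a genuine profinite group of the theory's
  own kind: the absolute Galois group `G_F` of a number field `F` is NOT topologically finitely generated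
  (the tree's `not_isTopologicallyFinitelyGenerated_absoluteGaloisGroup`, abc-iut-L4: infinitely many
  open subgroups of index `2`, i.e. infinitely many quadratic extensions).  Hence the UNIVERSAL CLOSURE of
  F-0263 is FALSE (`not_forall_def51CondA`, at `G_ℚ`).
* `def51CondA_of_finite` — the condition HOLDS for every finite profinite group (a finite generating set
  generates a dense subgroup), e.g. the trivial one (`def51CondA_punit`); genuine instances used by the
  cell are the pro-`Σ` completions of finitely generated groups
  (`IsProSigmaCompletion.isTopologicallyFinitelyGenerated_of_fg`, `ProSigmaCompletionTFG.lean`).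

FACT-LIST reading: F-0263 = «definition clause / hypothesis predicate on `π̂₁(A)`; universal closure
REFUTED at `G_ℚ`; inhabited».  Classical; no side taken on [IUTchIII] Cor. 3.12; a FACT row is an
assumption label; typed ≠ proved.
-/

noncomputable section

namespace Literature.AnabelianGeometry.SemiGraphs

open Literature.AnabelianGeometry.AbsoluteAnabelian

/-- **Def 5.1 (i)(a) fails at `π̂₁(A) := G_F`, `F` a number field**: the absolute Galois group of a number
field is not topologically finitely generated (tree theorem of abc-iut-L4, [AbsTopI] Thm 1.7 (iii)).
[cite: MochizukiSemiAnbd2006, Def 5.1 (i)(a), p. 62] -/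
theorem not_def51CondA_absoluteGaloisGrp (F : Type) [Field F] [NumberField F] :
    ¬ Def51CondA (absoluteGaloisGrp F) :=
  not_isTopologicallyFinitelyGenerated_absoluteGaloisGroup F

/-- **F-0263 is a definition clause: its universal closure is FALSE** (witness `G_ℚ`).
[cite: MochizukiSemiAnbd2006, Def 5.1 (i)(a), p. 62] -/
theorem not_forall_def51CondA : ¬ ∀ PA : ProfiniteGrp.{0}, Def51CondA PA :=
  fun h => not_def51CondA_absoluteGaloisGrp ℚ (h _)

/-- Def 5.1 (i)(a) holds for every FINITE profinite group: a finite generating set (which exists) generates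
a subgroup whose closure is everything. [cite: MochizukiSemiAnbd2006, Def 5.1 (i)(a), p. 62] -/
theorem def51CondA_of_finite (PA : ProfiniteGrp) [Finite PA] : Def51CondA PA := by
  obtain ⟨s, hs⟩ := Group.fg_def.mp (inferInstance : Group.FG PA)
  exact ⟨⟨s, by rw [hs]; exact top_le_iff.mp (Subgroup.le_topologicalClosure ⊤)⟩⟩

/-- … in particular for the trivial profinite group. [cite: MochizukiSemiAnbd2006, Def 5.1 (i)(a), p. 62] -/
theorem def51CondA_punit : Def51CondA (ProfiniteGrp.of PUnit.{1}) :=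
  def51CondA_of_finite _

/-- Summary: Def 5.1 (i)(a) takes both truth values on profinite groups (trivial group: true; `G_ℚ`:
false). [cite: MochizukiSemiAnbd2006, Def 5.1 (i)(a), p. 62] -/
theorem def51CondA_both_ways :
    (∃ PA : ProfiniteGrp.{0}, Def51CondA PA) ∧ ∃ PA : ProfiniteGrp.{0}, ¬ Def51CondA PA :=
  ⟨⟨_, def51CondA_punit⟩, _, not_def51CondA_absoluteGaloisGrp ℚ⟩

end Literature.AnabelianGeometry.SemiGraphs

end
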